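import Summits.Parity.BatemanHorn.Theses.RoughParitySectors
import Literature.NumberTheory.Sieve.IntervalResidueClassSieve
import HarnessLib

/-!
# Route `RoughParitySectors`, crux `RoughParityBalance` (stmt-Parity-15627), line `registered`:
# the registered stub `stub_roughCardLower` (engine E4)

`--supports` file of the checked skeleton `Summits/Parity/BatemanHorn/Cruxes/RoughParityBalance/Lines/birth.lean`
(crux `Summit.Parity.BatemanHorn.Theses.RoughParitySectors.RoughParityBalance`).  It PROVES the registered
stub `stub_roughCardLower` verbatim: for every Bateman–Horn system `f = (f₁, …, f_k)` there are `A` and `U₁`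
such that for every `U ≥ U₁`, eventually in `x`,

  `x / (log x)^A ≤ #R_f(x,U)`,  `R_f(x,U) = {1 ≤ n ≤ x : ∀ i, fᵢ(n) > 0 ∧ no prime p < x^{deg fᵢ/U} divides fᵢ(n)}`

(the jointly rough set of the system, staggered thresholds).  Everything used is PROVED in the tree:

* the relative band `Cruxes.RoughValueLaw.IncrementAnchoring.stub_sieveBand` at `ε = 1/2`, giving
  `#R_f(x,U) ≥ x·V_f(x,U)/2` with `V_f(x,U) = ∏_{p ≤ x} (1 − ω_f(x,U;p)/p)`,
  `ω_f(x,U;p) = #{r mod p : ∃ i, p < x^{deg fᵢ/U} ∧ p ∣ fᵢ(r)}`;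
* the lower bound `IntervalClassSieve.le_prod_one_sub_card_div` (`V ≥ c_S/(log z)^{2S}` for classes with
  `#Ω p ≤ S`, `#Ω p < p`), with `S = ∑ deg fᵢ`, `z = x + 1` and the dictionary lemmas
  `SieveBand.card_classes_le_sum`, `SieveBand.card_classes_lt`;
* `log (x+1) ≤ 2 log x` (`x ≥ 2`) and `log x ≥ 2^{2S+1}/c_S` eventually, so `A = 2S + 1` works;
  `k = 0`: `R = [1, x]`, `A = 0`.

No definition and no new fact is introduced.

References: H. Halberstam, H.-E. Richert, *Sieve Methods* (1974), Thm 2.5 (lower bound of the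
fundamental lemma); the line card `Cruxes/RoughParityBalance/Lines/birth.md`.
-/

noncomputable section

namespace Summit.Parity.BatemanHorn.Cruxes.RoughParityBalance.Birth

open scoped BigOperators Topology Classical
open Filter Finset
open Literature.NumberTheory.Sieve

/-- Real-analysis assembly at a fixed `x ≥ 2`: from `#R ≥ xV/2`, `V ≥ c/(log (x+1))^{2S}` and
`2^{2S+1}/c ≤ log x` conclude `x/(log x)^{2S+1} ≤ #R` (using `log (x+1) ≤ 2 log x`). [folklore] -/
theorem roughCardLower_assemble {x R V c : ℝ} {S : ℕ} (hx : 2 ≤ x) (hc : 0 < c)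
    (hcL : 2 ^ (2 * S + 1) / c ≤ Real.log x)
    (hV : c / Real.log (x + 1) ^ (2 * S) ≤ V) (hR : x * V / 2 ≤ R) :
    x / Real.log x ^ (2 * S + 1) ≤ R := by
  have hx0 : 0 ≤ x := by linarith
  have hM : 0 < Real.log (x + 1) := Real.log_pos (by linarith)
  have hL : 0 < Real.log x := Real.log_pos (by linarith)
  -- `log (x+1) ≤ log (x²) = 2 log x`
  have hML : Real.log (x + 1) ≤ 2 * Real.log x := by
    calc Real.log (x + 1) ≤ Real.log (x ^ 2) := Real.log_le_log (by linarith) (by nlinarith)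
      _ = 2 * Real.log x := by rw [Real.log_pow]; push_cast; ring
  have hM2S : Real.log (x + 1) ^ (2 * S) ≤ (2 * Real.log x) ^ (2 * S) :=
    pow_le_pow_left₀ hM.le hML _
  have hV' : c / ((2 : ℝ) ^ (2 * S) * Real.log x ^ (2 * S)) ≤ V := by
    rw [← mul_pow]
    exact le_trans (div_le_div_of_nonneg_left hc.le (pow_pos hM _) hM2S) hV
  have hcL' : (2 : ℝ) ^ (2 * S + 1) ≤ c * Real.log x := (div_le_iff₀' hc).mp hcL
  have hone : (1 : ℝ) ≤ c * Real.log x / 2 ^ (2 * S + 1) := by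
    rw [le_div_iff₀ (by positivity), one_mul]
    exact hcL'
  refine le_trans ?_ hR
  rw [pow_succ, div_le_iff₀ (by positivity)]
  calc x ≤ x * (c * Real.log x / 2 ^ (2 * S + 1)) := le_mul_of_one_le_right hx0 hone
    _ = x * (c / ((2 : ℝ) ^ (2 * S) * Real.log x ^ (2 * S))) / 2 *
          (Real.log x ^ (2 * S) * Real.log x) := by
        field_simp
        ring
    _ ≤ x * V / 2 * (Real.log x ^ (2 * S) * Real.log x) := by gcongr

/-- **Engine stub E4 — `stub_roughCardLower` (polylog lower bound for the jointly rough count).**  For every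
Bateman–Horn system `f` there are `A` and `U₁` such that for every `U ≥ U₁`, eventually in `x`,
`x/(log x)^A ≤ #R_f(x,U)`.  Proof: the band `IncrementAnchoring.stub_sieveBand` at `ε = 1/2`
(`#R ≥ xV_f(x,U)/2`) and `V_f(x,U) ≥ c/(log(x+1))^{2S}` (`IntervalClassSieve.le_prod_one_sub_card_div` with the
classes of `SieveBand`, `S = Σ deg fᵢ`), so `A = 2S + 1` works; `k = 0`: `#R = x`, `A = 0`.
[HalberstamRichert1974 Thm 2.5; folklore] -/
theorem stub_roughCardLower :
    ∀ (k : ℕ) (f : Fin k → Polynomial ℤ), IsBatemanHornSystem f →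
      ∃ A : ℝ, ∃ U₁ : ℝ, ∀ U : ℝ, U₁ ≤ U → ∀ᶠ x : ℕ in Filter.atTop,
        (x : ℝ) / Real.log x ^ A ≤
          ((((Finset.Icc 1 x).filter (fun n : ℕ => ∀ i, 0 < (f i).eval (n : ℤ) ∧
              ∀ p ∈ Finset.range ⌈(x : ℝ) ^ (((f i).natDegree : ℝ) / U)⌉₊,
                p.Prime → ¬ ((p : ℤ) ∣ (f i).eval (n : ℤ)))).card : ℕ) : ℝ) := by
  intro k f hf
  rcases Nat.eq_zero_or_pos k with hk | hk
  · subst hk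
    refine ⟨0, 0, fun U _ => Eventually.of_forall fun x => ?_⟩
    simp
  -- `k ≥ 1`: the degrees
  set S : ℕ := ∑ i, (f i).natDegree with hS
  obtain ⟨c, hc, hlow⟩ := IntervalClassSieve.le_prod_one_sub_card_div S
  obtain ⟨U₁, hband⟩ :=
    Summit.Parity.BatemanHorn.Cruxes.RoughValueLaw.IncrementAnchoring.stub_sieveBand k f hf (1 / 2)
      one_half_pos
  refine ⟨((2 * S + 1 : ℕ) : ℝ), U₁, fun U hU => ?_⟩
  have hlog : ∀ᶠ x : ℕ in atTop, (2 : ℝ) ^ (2 * S + 1) / c ≤ Real.log x :=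
    (Real.tendsto_log_atTop.comp tendsto_natCast_atTop_atTop).eventually (eventually_ge_atTop _)
  filter_upwards [hband U hU, hlog, eventually_ge_atTop 2] with x hbx hlogx hx2
  rw [Real.rpow_natCast]
  have hx2' : (2 : ℝ) ≤ x := by exact_mod_cast hx2
  -- the classes `Ω p = {r mod p : ∃ i, p < x^{deg fᵢ/U} ∧ p ∣ fᵢ(r)}`
  have hΩle : ∀ p : ℕ, p.Prime → #((range p).filter (fun r : ℕ => ∃ i,
      (p : ℝ) < (x : ℝ) ^ (((f i).natDegree : ℝ) / U) ∧ (p : ℤ) ∣ (f i).eval (r : ℤ))) ≤ S :=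
    fun p hp => by
      rw [hS]
      exact RoughValueLaw.IncrementAnchoring.SieveBand.card_classes_le_sum hf hp
        (fun i => (p : ℝ) < (x : ℝ) ^ (((f i).natDegree : ℝ) / U))
  have hΩp : ∀ p : ℕ, p.Prime → #((range p).filter (fun r : ℕ => ∃ i,
      (p : ℝ) < (x : ℝ) ^ (((f i).natDegree : ℝ) / U) ∧ (p : ℤ) ∣ (f i).eval (r : ℤ))) < p :=
    fun p hp => RoughValueLaw.IncrementAnchoring.SieveBand.card_classes_lt hf hp
      (fun i => (p : ℝ) < (x : ℝ) ^ (((f i).natDegree : ℝ) / U))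
  -- `V ≥ c / (log (x+1))^{2S}` (`z = x + 1`, `⌈z⌉₊ = x + 1`)
  have hz2 : (2 : ℝ) ≤ ((x + 1 : ℕ) : ℝ) := by push_cast; linarith
  have hV : c / Real.log ((x : ℝ) + 1) ^ (2 * S) ≤ ∏ p ∈ Nat.primesBelow (x + 1),
      (1 - (((range p).filter (fun r : ℕ => ∃ i,
          (p : ℝ) < (x : ℝ) ^ (((f i).natDegree : ℝ) / U) ∧
            (p : ℤ) ∣ (f i).eval (r : ℤ))).card : ℝ) / (p : ℝ)) := by
    have h := hlow (fun p => (range p).filter (fun r : ℕ => ∃ i,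
        (p : ℝ) < (x : ℝ) ^ (((f i).natDegree : ℝ) / U) ∧ (p : ℤ) ∣ (f i).eval (r : ℤ)))
      hΩle hΩp _ hz2
    rw [Nat.ceil_natCast] at h
    push_cast at h
    exact h
  -- `#R ≥ xV/2`
  have hR := (abs_le.mp hbx).1
  exact roughCardLower_assemble hx2' hc hlogx hV (by linarith)

end Summit.Parity.BatemanHorn.Cruxes.RoughParityBalance.Birth
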